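import Summits.QuantumFields.YangMills.Theorems.BalabanUVNodesN12FlatStraightOntoRows
import Literature.MathematicalPhysics.QuantumFieldTheory.Balaban1983to89.B14Eq213DetSet
import Literature.MathematicalPhysics.QuantumFieldTheory.Balaban1983to89.Node00.MultiScaleFibreChart
import Literature.MathematicalPhysics.QuantumFieldTheory.BalabanImbrieJaffe1984to88.BIJ88RT51Background
import Summits.QuantumFields.YangMills.Theorems.BalabanUVNodesN07CritMultiScaleLamBond
import HarnessLib

/-!
# BalabanUVNodes ∕ N12 — (J-b) module H1b: THE STRAIGHT MULTI-LEVEL AVERAGES `Q_j = bondAvgIter j` MAP ONTO THE DATA INDEXED BY [III] (2.2)∕(2.10)'s OWN INDEX SET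
# `ConstrSet (genSet Ω k) k` — r12's READING (b): the `j`-bonds MEETING `Γ_j`, the `Γ_j → Ω_{j+1}` crossing bonds INCLUDED — for every nested, block-measurable region
# family (NO collar), hence on the record's `𝐁_k(Z) = B14.Eq213DetSet.Bj M₁ Z k`; scalar, linear-right-inverse and vector-valued editions

Cell `pub-ymgap` (HUMAN RULINGS D-0062 ∕ D-0149), width seat `pub-ymgap-dag-n10-w1` g3; module H1a = `…N12FlatStraightOntoRows` (p615796).  Key K1⁷ `stmt-QuantumFields-20542`,
`--kind proof --supports … --as helper`; count-neutral; THEOREMS ONLY (0 `def`, 0 `sorry`, 0 `instance`, 0 `notation`).  WAY (ii) of the seat's located note (INBOX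
l.30547), straight half: the analogue of lit-balaban p21's `B6SectAOntoV1.exists_constr` ([B6] (2.3)-indexed, `BondIdx`) for the determining set of [III] (2.2) READ WITH
`bondsOf` — the index set n07-w2's chart `msChart … (Bj M₁ Z k)` and K0's `AgreeOn (genSet …)` are typed with (`Node00/GenSetVsLamBond`: it exceeds (2.3)'s `Λ_j` exactly by
the bonds joining `Γ_j` to `Ω_{j+1}`).  The TRUE linearised (0.4)-constraint `qLin j 1 = L^j·Q_j − dΛ_j` (UST `ChartHInv.linFamily_eq_sub_comb`) is module H2's business.

CONSUMED BY NAME, nothing modified: H1a (`exists_bondAvg_eq_on_rows`: the level step on safe bonds), p21's `B6SectAOntoV1` (`liftIter`, `bondAvgIter_liftIter`, `liftIter_support`,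
`bondAvgIterLin`), p11's `B5AveragingLocalityV1.bondAvg_eq_zero_of_local`, r12's `B15DeterminingSets` (`genSet`, `gammaRegion_zero∕_mid∕_self`, `bondsOf`, `pts`, `embIter`),
r11's `B14.Eq213DetSet` (`Bj`, `maxDomT`, `maxDomT_succ_subset`, `isBlockUnion_maxDomT`) and `B14.Eq22Determines.IsBlockUnion`, p39's `B5Eq118OneStroke.iterBlockOf`,
`BIJ88RT51Background.iterBlockOf_embIter`, n07-e's `N07CritMultiScaleLamBond.iterBlockOf_congr_of_le`, n07-w2's `Node00.ConstrSet`, p09's `bondAvgIter_add∕_smul`, Mathlib's `LinearMap.exists_rightInverse_of_surjective`.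

CONTENTS.  §1 ★ `bondAvgIter_eq_zero_of_vanish` — multi-level block locality of `Q_i` (`(Q_iF)(c)` reads only the fine bonds with both end-points over `B^i(c₋) ∪ B^i(c₊)`).
§2 ★★ `bondAvgIter_liftIter_eq_zero_of_safe` — READING-(b) CROSS-LEVEL VANISHING: a level-`n` field whose supporting bonds have BOTH end blocks inside a
fine region `S` lifts (`liftIter n`) to a fine field with zero `i`-fold average (`i ≤ n`) at every `i`-bond ONE of whose end blocks is disjoint from `S` (p21's
`bondAvgIter_liftIter_eq_zero_of_out` is the (2.3) edition: support entering `Ω_{n+1}`, both end blocks outside).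
§3 `mem_iff_embIter_iterBlockOf_mem` (a union of `j`-blocks read at a finer scale), `embIter_mem_of_mem_genSet`, `embIter_not_mem_succ_of_mem_genSet`, `subset_of_nested`,
`exists_bondAvgIter_eq_on_genSet_le` (the fine-to-coarse induction: `A_{n+1} = A_n + liftIter n Z_{n+1}`, `Z_{n+1}` from H1a with `In W ⇔ centre of W ∈ Ω_{n+1}`, rows = bonds
meeting `Γ_{n+1}`; the levels `≤ n` are undisturbed by §2 because a level-`i` row has an end-point in `Γ_i`, whose block misses `Ω_{i+1} ⊇ Ω_{n+1}`), ★★★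
`exists_bondAvgIter_eq_on_genSet` — for `k ≤ m + K`, `Ω_{i+1} ⊆ Ω_i` and `Ω_i` a union of `i`-blocks (`1 ≤ i ≤ k`): every family of targets on the bonds MEETING the `Γ_i` is
`(Q_iA)(c)` of one fine field `A` — NO collar between the `Ω_i` needed; ★★★ `exists_bondAvgIter_eq_on_Bj` (at `Bj M₁ Z k`: `1 ≤ M₁`, `k ≤ m + K`, `L^k·M₁ ∣ sitesPerDir 0`).
§4 `exists_bondAvgIter_eq_on_constrSet` (data on n07-w2's `ConstrSet (genSet Ω k) k`), ★★ `exists_linear_rightInverse_bondAvgIter_genSet` (a LINEAR right inverse),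
`bondAvgIter_smul_const`, ★★ `exists_linear_rightInverse_bondAvgIter_genSet_vec` (values in any real vector space `V`: `H_V Y = Σ_idx H(δ_idx) ⊗ Y(idx)`),
★★★ `exists_linear_rightInverse_bondAvgIter_Bj`.

HONEST FRAMING.  Finite lattice combinatorics + linear algebra over `ℝ` on the tree's straight averages; no estimate ((46)-type letters NOT claimed for reading (b)); nothing
of Bałaban's analysis asserted; the ME #35 question (reading (b) vs (2.3)) is NOT adjudicated — the file shows the (b)-system of [III] (2.2)∕(2.10) is solvable as typed.
N12 ∕ N10 ∕ N07 NOT discharged; K1⁷ NOT closed; count-neutral (typed 28∕28 · discharged 5∕27 unmoved); one finite 𝕋⁴ programme at fixed ε — R4 closes the conditional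
rung `BalabanLadder.UV` only; the YM mass gap (Clay) is NOT proved by any of this; nothing continuum ∕ ℝ⁴ ∕ OS.
-/

noncomputable section

open scoped BigOperators

namespace Summit.QuantumFields.YangMills.BalabanUVNodes.N12FlatStraightOntoGenSet

open Literature.MathematicalPhysics.QuantumFieldTheory.Balaban1983to89
open LatticeFieldCalculus B5Eq118OneStroke B5Eq120IterProof B5AveragingLocalityV1 B15DeterminingSets
open B6SectAOntoV1 (liftIter bondAvgIter_liftIter liftIter_support bondAvgIterLin bondAvgIterLin_apply)
open B14.Eq22Determines (IsBlockUnion blockIter blockIter_zero blockIter_succ)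
open B14.Eq213DetSet (Bj maxDomT maxDomT_succ_subset isBlockUnion_maxDomT)
open B14.Eq213MaximalDomains (side)
open Node00 (ConstrSet)
open Literature.MathematicalPhysics.QuantumFieldTheory.BalabanImbrieJaffe1984to88.BIJ85AxialPropagator411 (bondAvgIter_add bondAvgIter_smul)
open Literature.MathematicalPhysics.QuantumFieldTheory.BalabanImbrieJaffe1984to88.BIJ88RT51Background (iterBlockOf_embIter)
open N12FlatStraightOntoRows (exists_bondAvg_eq_on_rows)
open N07CritMultiScaleLamBond (iterBlockOf_congr_of_le)

variable {P : Params}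

/-! ## §1  Multi-level block locality of `Q_i`: `(Q_iF)(c)` only sees the fine bonds whose end-points lie over `c₋` or `c₊` -/

section Locality

variable {V : Type*} [AddCommGroup V] [Module ℝ V]

/-- **MULTI-LEVEL LOCALITY OF `Q_i`** (iterate of `B5AveragingLocalityV1.bondAvg_eq_zero_of_local`): if a fine bond field vanishes on every fine bond whose two
end-points lie over the end blocks `B^i(c₋) ∪ B^i(c₊)` of an `i`-bond `c`, then `(Q_iF)(c) = 0` (standing range `i ≤ m + K`).
[cite: Balaban1984PropagatorsI, (1.18) p.20] -/
theorem bondAvgIter_eq_zero_of_vanish (F : VecField P 0 V) :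
    ∀ (i : ℕ), i ≤ P.m + P.K → ∀ c : PBond P i,
      (∀ b : PBond P 0, (iterBlockOf i b.src = c.src ∨ iterBlockOf i b.src = c.tgt) →
        (iterBlockOf i b.tgt = c.src ∨ iterBlockOf i b.tgt = c.tgt) → F b = 0) →
      bondAvgIter i F c = 0
  | 0, _, c, h => by
    rw [bondAvgIter_zero]
    exact h c (Or.inl rfl) (Or.inr rfl)
  | i + 1, hi, c, h => by
    rw [bondAvgIter_succ]
    refine bondAvg_eq_zero_of_local hi _ c fun e hes het => ?_
    refine bondAvgIter_eq_zero_of_vanish F i (Nat.le_of_succ_le hi) e fun b hbs hbt => h b ?_ ?_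
    · rw [iterBlockOf_succ]
      rcases hbs with hb | hb <;> rw [hb]
      · exact hes
      · exact het
    · rw [iterBlockOf_succ]
      rcases hbt with hb | hb <;> rw [hb]
      · exact hes
      · exact het

end Locality

/-! ## §2  Cross-level vanishing, reading-(b) edition: a level-`n` field whose supporting bonds have BOTH end blocks inside a fine region `S` lifts to a fine field
invisible to every `i`-bond (`i ≤ n`) one of whose end blocks AVOIDS `S` -/

section Safe

/-- ★ **CROSS-LEVEL VANISHING (reading (b))**: let `Z` be a level-`n` bond field such that every bond in its support has BOTH end blocks (of order `n`) inside the fine region `S`;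
then the `i`-fold average (`i ≤ n`) of the `n`-fold far-face lift `liftIter n Z` vanishes at every `i`-bond ONE of whose end blocks (of order `i`) is disjoint from `S` — the
lift lives on fine bonds crossing an `n`-face between two blocks inside `S` (`liftIter_support`), such a bond crosses an `i`-face too, so both end blocks of the `i`-bond would meet
`S` (§1 locality).  (p21's `bondAvgIter_liftIter_eq_zero_of_out` is the [B6] (2.3) edition: support entering `Ω_{n+1}`, both end blocks outside.) [cite: Balaban1984PropagatorsII, (2.3)-(2.6) p.224; Balaban1988Convergent, (2.2) p.255, (2.10) p.256] -/
theorem bondAvgIter_liftIter_eq_zero_of_safe {n : ℕ} (hn : n ≤ P.m + P.K) (S : Set (Site P 0)) (Z : VecField P n ℝ)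
    (hZ : ∀ e : PBond P n, Z e ≠ 0 → (∀ x, iterBlockOf n x = e.src → x ∈ S) ∧ (∀ x, iterBlockOf n x = e.tgt → x ∈ S))
    {i : ℕ} (hi : i ≤ n) (c : PBond P i)
    (hc : (∀ x, iterBlockOf i x = c.src → x ∉ S) ∨ (∀ x, iterBlockOf i x = c.tgt → x ∉ S)) :
    bondAvgIter i (liftIter n Z) c = 0 := by
  refine bondAvgIter_eq_zero_of_vanish _ i (hi.trans hn) c fun b hbs hbt => ?_
  by_contra hb
  obtain ⟨h1, h2⟩ := liftIter_support n hn Z b hb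
  obtain ⟨hsS, htS⟩ := hZ _ h1
  have hsrc : b.src ∈ S := hsS b.src rfl
  have htgt : b.tgt ∈ S := htS b.tgt h2
  have hne : iterBlockOf i b.src ≠ iterBlockOf i b.tgt := fun h => by
    have h3 := congrFun (h2.symm.trans (iterBlockOf_congr_of_le hi h).symm) b.dir
    simp only [Site.shift, Function.update_self] at h3
    exact one_ne_zero (add_eq_left.1 h3)
  rcases hc with hc | hc
  · rcases hbs with hs | hs
    · exact hc _ hs hsrc
    · rcases hbt with ht | ht
      · exact hc _ ht htgt
      · exact hne (hs.trans ht.symm)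
  · rcases hbs with hs | hs
    · rcases hbt with ht | ht
      · exact hne (hs.trans ht.symm)
      · exact hc _ ht htgt
    · exact hc _ hs hsrc

end Safe

/-! ## §3  The fine-to-coarse induction for a nested, block-measurable region family `Ω₁ ⊇ Ω₂ ⊇ ⋯ ⊇ Ω_k` and its determining set `genSet Ω k` ([III] (2.2)) -/

section GenSet

/-- p11∕r11's `blockIter` is p39's `iterBlockOf`. [cite: Balaban1984PropagatorsI, (1.18) p.20] -/
theorem blockIter_eq_iterBlockOf : ∀ (j : ℕ) (x : Site P 0), blockIter j x = iterBlockOf j x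
  | 0, _ => rfl
  | j + 1, x => by rw [blockIter_succ, iterBlockOf_succ, blockIter_eq_iterBlockOf j x]

/-- A union of `j`-blocks is read at any finer scale `i ≤ j`: `x ∈ X ↔` the centre of the `i`-block of `x` lies in `X` (standing range `i ≤ m + K`).
[cite: Balaban1988Convergent, (2.1)-(2.2) p.255] -/
theorem mem_iff_embIter_iterBlockOf_mem {X : Set (Site P 0)} {j i : ℕ} (hX : IsBlockUnion j X) (hij : i ≤ j) (hiK : i ≤ P.m + P.K)
    (x : Site P 0) : x ∈ X ↔ embIter i (iterBlockOf i x) ∈ X := by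
  rw [hX x, hX (embIter i (iterBlockOf i x)), blockIter_eq_iterBlockOf, blockIter_eq_iterBlockOf,
    iterBlockOf_congr_of_le hij (iterBlockOf_embIter i hiK (iterBlockOf i x))]

variable (Ω : ℕ → Set (Site P 0)) {k : ℕ}

/-- A member site of `Γ_i` (`1 ≤ i ≤ k`) has its centre in `Ω_i`. [cite: Balaban1988Convergent, (2.2) p.255] -/
theorem embIter_mem_of_mem_genSet {i : ℕ} (hi1 : 1 ≤ i) (hik : i ≤ k) {w : Site P i} (hw : w ∈ genSet Ω k i) : embIter i w ∈ Ω i := by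
  rw [genSet, mem_pts] at hw
  rcases Nat.lt_or_eq_of_le hik with hlt | rfl
  · rw [gammaRegion_mid Ω (by omega) hlt] at hw; exact hw.1
  · rw [gammaRegion_self] at hw; exact hw

/-- A member site of `Γ_i` (`i < k`) has its centre OUTSIDE `Ω_{i+1}` (`Γ₀ = Ω₁ᶜ`, `Γ_i = Ω_i∖Ω_{i+1}`). [cite: Balaban1988Convergent, (2.2) p.255] -/
theorem embIter_not_mem_succ_of_mem_genSet {i : ℕ} (hik : i < k) {w : Site P i} (hw : w ∈ genSet Ω k i) : embIter i w ∉ Ω (i + 1) := by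
  rw [genSet, mem_pts] at hw
  rcases Nat.eq_zero_or_pos i with rfl | hpos
  · rw [gammaRegion_zero Ω hik] at hw; exact hw
  · rw [gammaRegion_mid Ω hpos hik] at hw; exact hw.2

/-- Nestedness iterated: `Ω_b ⊆ Ω_a` for `1 ≤ a ≤ b ≤ k`. [cite: Balaban1988Convergent, (2.1) p.255] -/
theorem subset_of_nested (hnest : ∀ i, 1 ≤ i → i < k → Ω (i + 1) ⊆ Ω i) {a b : ℕ} (ha : 1 ≤ a) (hab : a ≤ b) (hbk : b ≤ k) : Ω b ⊆ Ω a := by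
  obtain ⟨s, rfl⟩ := Nat.exists_eq_add_of_le hab
  induction s with
  | zero => simp
  | succ s ih => exact (hnest (a + s) (by omega) (by omega)).trans (ih (by omega) (by omega))

/-- The induction: after `n` steps the construction meets every reading-(b) row of the levels `≤ n` (`n ≤ k ≤ m + K`).
[cite: Balaban1988Convergent, (2.2) p.255, (2.10) p.256; Balaban1984PropagatorsII, (2.6) p.224] -/
theorem exists_bondAvgIter_eq_on_genSet_le (hkK : k ≤ P.m + P.K) (hnest : ∀ i, 1 ≤ i → i < k → Ω (i + 1) ⊆ Ω i)
    (hmeas : ∀ i, 1 ≤ i → i ≤ k → IsBlockUnion i (Ω i)) (B : (i : ℕ) → VecField P i ℝ) :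
    ∀ n, n ≤ k → ∃ A : VecField P 0 ℝ, ∀ i, i ≤ n → ∀ c ∈ bondsOf (genSet Ω k i), bondAvgIter i A c = B i c
  | 0, _ => ⟨B 0, fun i hi c _ => by obtain rfl := Nat.le_zero.mp hi; rfl⟩
  | n + 1, hn => by
    obtain ⟨A, hA⟩ := exists_bondAvgIter_eq_on_genSet_le hkK hnest hmeas B n (Nat.le_of_succ_le hn)
    have hnK : n + 1 ≤ P.m + P.K := hn.trans hkK
    obtain ⟨Z, hZrow, hZsupp⟩ := exists_bondAvg_eq_on_rows hnK (fun W => embIter (n + 1) W ∈ Ω (n + 1))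
      (fun c => c ∈ bondsOf (genSet Ω k (n + 1)))
      (fun c hc => hc.imp (embIter_mem_of_mem_genSet Ω (by omega) hn) (embIter_mem_of_mem_genSet Ω (by omega) hn))
      (fun c => B (n + 1) c - bondAvgIter (n + 1) A c)
    refine ⟨A + liftIter n Z, fun i hi c hc => ?_⟩
    rw [bondAvgIter_add, Pi.add_apply]
    rcases Nat.lt_or_eq_of_le hi with hlt | rfl
    · -- the levels `i ≤ n` are not disturbed
      have hin : i ≤ n := Nat.lt_succ_iff.mp hlt
      rw [hA i hin c hc, bondAvgIter_liftIter_eq_zero_of_safe (by omega) (Ω (n + 1)) Z ?_ hin c ?_, add_zero]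
      · intro e he
        obtain ⟨hs, ht⟩ := hZsupp e he
        have key : ∀ (w : Site P n) (x : Site P 0), embIter (n + 1) (blockOf w) ∈ Ω (n + 1) → iterBlockOf n x = w → x ∈ Ω (n + 1) :=
          fun w x hw hx => (mem_iff_embIter_iterBlockOf_mem (hmeas (n + 1) (by omega) hn) le_rfl hnK x).2 (by rwa [iterBlockOf_succ, hx])
        exact ⟨fun x hx => key _ x hs hx, fun x hx => key _ x ht hx⟩
      · have key : ∀ w : Site P i, w ∈ genSet Ω k i → ∀ x, iterBlockOf i x = w → x ∉ Ω (n + 1) := by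
          intro w hw x hx hxS
          have hxi : x ∈ Ω (i + 1) := subset_of_nested Ω hnest (by omega) (by omega : i + 1 ≤ n + 1) hn hxS
          have h1 := (mem_iff_embIter_iterBlockOf_mem (hmeas (i + 1) (by omega) (by omega)) (Nat.le_succ i) (by omega) x).1 hxi
          rw [hx] at h1
          exact embIter_not_mem_succ_of_mem_genSet Ω (by omega) hw h1
        rcases hc with hw | hw
        · exact Or.inl (key _ hw)
        · exact Or.inr (key _ hw)
    · -- the level `n + 1` itself
      rw [bondAvgIter_succ n (liftIter n Z), bondAvgIter_liftIter n (by omega) Z, hZrow c hc]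
      ring

/-- ★★★ **`Q` IS ONTO THE READING-(b) CONSTRAINT DATA OF A NESTED, BLOCK-MEASURABLE FAMILY**: for `k ≤ m + K`, `Ω_{i+1} ⊆ Ω_i` and `Ω_i` a union of `i`-blocks (`1 ≤ i ≤ k`), and
every family of targets `B_i` there is a fine bond field `A` on `T_η` with `(Q_iA)(c) = B_i(c)` at EVERY `i`-bond `c` MEETING `Γ_i` ([III] (2.2): `Γ₀ = Ω₁ᶜ`, `Γ_i = Ω_i∖Ω_{i+1}`,
`Γ_k = Ω_k`), all `i ≤ k` — the constraints (2.10)∕(2.12) read with `bondsOf` are independent at the flat configuration; NO collar between the `Ω_i` is needed.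
[cite: Balaban1988Convergent, (2.2) p.255, (2.10)-(2.12) p.256; Balaban1984PropagatorsII, (2.6) p.224] -/
theorem exists_bondAvgIter_eq_on_genSet (hkK : k ≤ P.m + P.K) (hnest : ∀ i, 1 ≤ i → i < k → Ω (i + 1) ⊆ Ω i)
    (hmeas : ∀ i, 1 ≤ i → i ≤ k → IsBlockUnion i (Ω i)) (B : (i : ℕ) → VecField P i ℝ) :
    ∃ A : VecField P 0 ℝ, ∀ i, i ≤ k → ∀ c ∈ bondsOf (genSet Ω k i), bondAvgIter i A c = B i c :=
  exists_bondAvgIter_eq_on_genSet_le Ω hkK hnest hmeas B k le_rfl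

/-- ★★★ **THE SAME AT THE RECORD's `𝐁_k(Z) = Bj M₁ Z k`** ([III] (2.13): the maximal sequence of a domain `Z`): `1 ≤ M₁`, `k ≤ m + K`, cover divisibility `L^k·M₁ ∣ sitesPerDir 0`;
nesting from `maxDomT_succ_subset`, block-measurability from `isBlockUnion_maxDomT`. [cite: Balaban1988Convergent, (2.13) pp.256-257, (2.10)-(2.12) p.256] -/
theorem exists_bondAvgIter_eq_on_Bj {M₁ : ℕ} (hM : 1 ≤ M₁) (hkK : k ≤ P.m + P.K) {Z : Set (Site P 0)} (hdiv : side P.L M₁ k ∣ P.sitesPerDir 0)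
    (B : (i : ℕ) → VecField P i ℝ) :
    ∃ A : VecField P 0 ℝ, ∀ i, i ≤ k → ∀ c ∈ bondsOf ((Bj M₁ Z k : DetSet P) i), bondAvgIter i A c = B i c :=
  exists_bondAvgIter_eq_on_genSet (maxDomT M₁ Z) hkK (fun i _ _ => maxDomT_succ_subset hM Z i)
    (fun _ hi1 hik => isBlockUnion_maxDomT hM hdiv hi1 hik (hik.trans hkK)) B

end GenSet

/-! ## §4  Packaging on n07-w2's index type `ConstrSet 𝐁 k`: surjectivity, a LINEAR right inverse, and vector-valued data -/

section Packaging

variable (Ω : ℕ → Set (Site P 0)) {k : ℕ}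

/-- **Surjectivity on `ConstrSet (genSet Ω k) k → ℝ`.** [cite: Balaban1988Convergent, (2.2) p.255, (2.10)-(2.12) p.256] -/
theorem exists_bondAvgIter_eq_on_constrSet (hkK : k ≤ P.m + P.K) (hnest : ∀ i, 1 ≤ i → i < k → Ω (i + 1) ⊆ Ω i)
    (hmeas : ∀ i, 1 ≤ i → i ≤ k → IsBlockUnion i (Ω i)) (Y : ConstrSet (genSet Ω k) k → ℝ) :
    ∃ A : VecField P 0 ℝ, ∀ idx : ConstrSet (genSet Ω k) k, bondAvgIter (idx.1 : ℕ) A idx.2.1 = Y idx := by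
  classical
  obtain ⟨A, hA⟩ := exists_bondAvgIter_eq_on_genSet Ω hkK hnest hmeas
    (fun i c => if h : i ≤ k ∧ c ∈ bondsOf (genSet Ω k i) then Y ⟨⟨i, Nat.lt_succ_of_le h.1⟩, c, h.2⟩ else 0)
  refine ⟨A, fun idx => ?_⟩
  obtain ⟨⟨i, hi⟩, c, hc⟩ := idx
  rw [hA i (Nat.lt_succ_iff.mp hi) c hc, dif_pos ⟨Nat.lt_succ_iff.mp hi, hc⟩]

/-- ★★ **A LINEAR RIGHT INVERSE** of `A ↦ ((Q_jA)(c))_{(j,c) ∈ ConstrSet (genSet Ω k) k}` (from surjectivity, `LinearMap.exists_rightInverse_of_surjective`).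
[cite: Balaban1988Convergent, (2.10)-(2.12) p.256; Balaban1985Variational, (45) p.285] -/
theorem exists_linear_rightInverse_bondAvgIter_genSet (hkK : k ≤ P.m + P.K) (hnest : ∀ i, 1 ≤ i → i < k → Ω (i + 1) ⊆ Ω i)
    (hmeas : ∀ i, 1 ≤ i → i ≤ k → IsBlockUnion i (Ω i)) :
    ∃ H : (ConstrSet (genSet Ω k) k → ℝ) →ₗ[ℝ] VecField P 0 ℝ,
      ∀ (Y : ConstrSet (genSet Ω k) k → ℝ) (idx : ConstrSet (genSet Ω k) k), bondAvgIter (idx.1 : ℕ) (H Y) idx.2.1 = Y idx := by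
  let T : VecField P 0 ℝ →ₗ[ℝ] (ConstrSet (genSet Ω k) k → ℝ) :=
    { toFun := fun A idx => bondAvgIter (idx.1 : ℕ) A idx.2.1
      map_add' := fun A A' => funext fun idx => by rw [bondAvgIter_add]; rfl
      map_smul' := fun r A => funext fun idx => by rw [bondAvgIter_smul]; rfl }
  have hT : LinearMap.range T = ⊤ := LinearMap.range_eq_top.mpr fun Y => by
    obtain ⟨A, hA⟩ := exists_bondAvgIter_eq_on_constrSet Ω hkK hnest hmeas Y
    exact ⟨A, funext hA⟩
  obtain ⟨H, hH⟩ := T.exists_rightInverse_of_surjective hT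
  exact ⟨H, fun Y idx => by
    have := LinearMap.congr_fun hH Y
    exact congrFun this idx⟩

variable {V : Type*} [AddCommGroup V] [Module ℝ V]

/-- `Q_i` of a scalar field times a fixed vector is the scalar average times the vector. [cite: Balaban1984PropagatorsI, (1.18) p.20] -/
theorem bondAvgIter_smul_const (f : VecField P 0 ℝ) (v : V) : ∀ (i : ℕ) (c : PBond P i),
    bondAvgIter i (fun b => f b • v) c = bondAvgIter i f c • v
  | 0, c => rfl
  | i + 1, c => by
    rw [bondAvgIter_succ, bondAvgIter_succ, show bondAvgIter i (fun b => f b • v) = fun b => bondAvgIter i f b • v from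
      funext (bondAvgIter_smul_const f v i)]
    simp only [bondAvg, segSum, Finset.smul_sum, smul_smul, smul_eq_mul]
    rw [Finset.mul_sum, Finset.sum_smul]
    refine Finset.sum_congr rfl fun r _ => ?_
    rw [Finset.mul_sum, Finset.sum_smul]

/-- ★★ **VECTOR-VALUED DATA, LINEARLY**: for any real vector space `V` a linear `H_V : (ConstrSet (genSet Ω k) k → V) → (fine bonds → V)` with `(Q_j(H_V Y))(c) = Y(j,c)` on the rows
(the scalar right inverse against a basis of the data: `H_V Y = Σ_idx H(δ_idx) ⊗ Y(idx)`). [cite: Balaban1988Convergent, (2.10)-(2.12) p.256; Balaban1985Variational, (45) p.285] -/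
theorem exists_linear_rightInverse_bondAvgIter_genSet_vec (hkK : k ≤ P.m + P.K) (hnest : ∀ i, 1 ≤ i → i < k → Ω (i + 1) ⊆ Ω i)
    (hmeas : ∀ i, 1 ≤ i → i ≤ k → IsBlockUnion i (Ω i)) :
    ∃ H : (ConstrSet (genSet Ω k) k → V) →ₗ[ℝ] VecField P 0 V,
      ∀ (Y : ConstrSet (genSet Ω k) k → V) (idx : ConstrSet (genSet Ω k) k), bondAvgIter (idx.1 : ℕ) (H Y) idx.2.1 = Y idx := by
  classical
  obtain ⟨H, hH⟩ := exists_linear_rightInverse_bondAvgIter_genSet Ω hkK hnest hmeas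
  let HV : (ConstrSet (genSet Ω k) k → V) →ₗ[ℝ] VecField P 0 V :=
    { toFun := fun Y b => ∑ idx, H (Pi.single idx 1) b • Y idx,
      map_add' := fun Y Y' => funext fun b => by simp only [Pi.add_apply, smul_add, Finset.sum_add_distrib],
      map_smul' := fun r Y => funext fun b => by simp only [Pi.smul_apply, RingHom.id_apply, Finset.smul_sum, smul_comm r] }
  refine ⟨HV, fun Y idx => ?_⟩
  show bondAvgIter (idx.1 : ℕ) (fun b => ∑ i, H (Pi.single i 1) b • Y i) idx.2.1 = Y idx
  rw [show (fun b => ∑ i, H (Pi.single i 1) b • Y i) = ∑ i, (fun b => H (Pi.single i 1) b • Y i) from by funext b; simp only [Finset.sum_apply],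
    ← bondAvgIterLin_apply, map_sum, Finset.sum_apply]
  simp only [bondAvgIterLin_apply, bondAvgIter_smul_const, hH, Pi.single_apply, ite_smul, one_smul, zero_smul]
  rw [Finset.sum_ite_eq, if_pos (Finset.mem_univ _)]

/-- ★★★ **VECTOR-VALUED DATA AT `𝐁_k(Z)`**: a linear right inverse of the straight multi-level averages on the reading-(b) rows of the record's determining set.
[cite: Balaban1988Convergent, (2.13) pp.256-257, (2.10)-(2.12) p.256; Balaban1985Variational, (45) p.285] -/
theorem exists_linear_rightInverse_bondAvgIter_Bj {M₁ : ℕ} (hM : 1 ≤ M₁) (hkK : k ≤ P.m + P.K) {Z : Set (Site P 0)} (hdiv : side P.L M₁ k ∣ P.sitesPerDir 0) :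
    ∃ H : (ConstrSet (Bj M₁ Z k : DetSet P) k → V) →ₗ[ℝ] VecField P 0 V,
      ∀ (Y : ConstrSet (Bj M₁ Z k : DetSet P) k → V) (idx : ConstrSet (Bj M₁ Z k : DetSet P) k), bondAvgIter (idx.1 : ℕ) (H Y) idx.2.1 = Y idx :=
  exists_linear_rightInverse_bondAvgIter_genSet_vec (maxDomT M₁ Z) hkK (fun i _ _ => maxDomT_succ_subset hM Z i)
    (fun _ hi1 hik => isBlockUnion_maxDomT hM hdiv hi1 hik (hik.trans hkK))

end Packaging

end Summit.QuantumFields.YangMills.BalabanUVNodes.N12FlatStraightOntoGenSet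

end
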